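import Summits.CriticalPhenomena.PercolationContinuityZ3.Theorems.FK.Transplant.KNFreeRegressionQOneRecord
import Summits.CriticalPhenomena.PercolationContinuityZ3.Theorems.FK.ContinuityCruxDefs
import Summits.CriticalPhenomena.PercolationContinuityZ3.Theorems.PercNearOneGluingNoHeavySamePZd
import HarnessLib

/-!
# G-T2, part 4: the TYPED crux C3a at `q = 1` (FT-09 follow-up; FO-05 regression note)

builds on p205010 (kernel theorem, internal audit signed; external expert review pending).
Cell `fk-continuity`, transplant sub-cell. **CONDITIONAL sub-cell context: `FH` and `KNFreeTargetHittable`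
(= TP_FK) are OPEN at the same `p` for `q > 1` (⇔ Grimmett 2006 Conj. (5.103) via K1; barrier note
`Literature.Barriers.CriticalPhenomena.SamePFreeBoundaryCriteria`, decl `samePFreeBoundaryCriteria`); the transplant
is a typed reduction, not a proof of FK continuity.** FO-19 = NO-GO ⇒ the cruxes of `ContinuityCruxDefs.lean` are
programme statements (`def … : Prop`), none asserted.

This file records that the `q = 1` instance of the TYPED same-`p` free-boundary criterion C3a,
`FKCriterionOfThetaFree d 1 ε₀` (`ContinuityCruxDefs.lean`), is an unconditional tree theorem for `d ≥ 3`,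
`ε₀ > 0`: it is FT-09 part 3's `ufsc0_one_of_theta_pos` (the transplant record `ufsc0_of_freeBoundaryHypothesis_r0`
fed with the six `q = 1` regressions — VIA p205010's gluing: `CSH.additiveGluing_holds` is in the cone, through the TP
regression `knFreeTargetHittable_one` ← `Quant.targetProperty_of_theta_pos`, 234 `Theorems.CSH.*` constants; the headline
declarations `CSH.percolationContinuityZ3_holds` / `CSH.kozmaNitzan_conjecture3_holds` and the conditional Prop
`KozmaNitzan2024_conjecture3` are in no cone; fk-ref R-g13-1) read through the FO-02 bridge `θ⁰(p,1) = θ(p)`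
(`thetaFree_one_right_eq_theta`, `ContinuityQOneBridge.lean`) — the same move as `fh_one_of_thetaFree_pos`
(`KNFreeRegressionQOne.lean`). No new mathematics: typed-form bookkeeping so that the registry can say
"C3a at `q = 1` is a tree theorem in the typed form" (fkp-18r §16 F35; cell rulings R32 (5) / R33 (6); text of the
two theorems = fkp-05 gen 3's kernel-checked scratch `CruxQOneScratch2.lean` §NEW). For `q > 1` nothing is claimed.
§9 (v2, additive) records the `q = 1` regression of the one OTHER typed Prop of `ContinuityCruxDefs.lean` that
regresses without the C1/C2/C3b machinery: `NoUFSC0AtCritical d 1 ε₀` (`4ε₀ < 2⁻³²`, `d ≥ 1`). A `UFSC0 d 1 p r ε₀`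
witness makes Kozma–Nitzan's exploration scheme lawful in the TREE's sense (`KSch.lawful`: (32)-FK at the origin is
`hQ0` by `originFK_one_iff`, FK-valid = valid by `validFK_one_iff`, the minimal law at `q = 1` is `prodBernoulli (Wfull)`
by `fkLaw_Wfull_one`, which agrees with `P_p` on the bad event, `KSch.real_bad_eq`; a failed examination has one of
`≤ 4` bad onward directions, `KSch.not_succ_subset`), and the tree's same-`p` continuation principle
`SameP.criticalProb_lt_of_lawful` (with the uniform envelope bound `SameP.card_env_le_of_next` and the certificate
`KSch.mem_percolatesVia_of_infinite`) gives `p_c(ℤ^d) < p`; at `p = p_c(1) = p_c(ℤ^d)` this is absurd. This is the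
conclusion of the seam `rcCriticalProb_lt_of_ufsc0` at `q = 1`, UNCONDITIONALLY, through the `q = 1` chain — not the
typed C2 (`FKContinuationPrinciple`, row FO-11) nor C3b (`FKLawfulOfCriterion`, row FT-07), which are general-`q`
statements about `FKScheme`/`FKRobustLawful` and are not touched here. (The extra import
`…Theorems.PercNearOneGluingNoHeavySamePZd` supplies `SameP.card_env_le_of_next`.) CONE RECORD (fk-ref g13 run and the
writer's re-run): §9's five theorems are gluing-free — 0 `Theorems.CSH.*` constants — whereas §8's
`fkCriterionOfThetaFree_one` / `_three_one` inherit the 234 `CSH.*` constants of `ufsc0_one_of_theta_pos`; so "C3a at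
`q = 1` is a tree theorem" reads "VIA p205010's gluing", while FH at `q = 1` (`fh_one_of_theta_pos`) and the C2 ∧ C3b seam
at `q = 1` (`noUFSC0AtCritical_one`) are gluing-free.
Writer + proposer: seat prim-bschramm-fkp-01 (gen 3).
[cite: KozmaNitzan2024, §4 Theorem 6 (pp. 25–31) with Lemmas 9–12] [cite: Grimmett2006, §5.1 (5.1), Conj. (5.103)]
-/

noncomputable section

namespace Summit.CriticalPhenomena.PercolationContinuityZ3.Theorems.FK

open MeasureTheory Literature.Probability.Percolation Literature.Probability.LatticeModels SimpleGraph
open Literature.Probability.Percolation.GadgetSystem Literature.Probability.Percolation.KozmaNitzan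
open Literature.Barriers.CriticalPhenomena

variable {d : ℕ}

/-! ### 8. C3a at `q = 1` in the typed form -/

/-- **C3a at `q = 1` is a tree theorem in the TYPED form**: for `d ≥ 3` and `ε₀ > 0`,
`FKCriterionOfThetaFree d 1 ε₀` — for every `p ∈ (0,1)` with `θ⁰(p,1) > 0` there is a scale `r` with
`UFSC0 d 1 p r ε₀` — from `ufsc0_one_of_theta_pos` (FT-09 part 3) and `θ⁰(p,1) = θ(p)` (FO-02); cone: VIA p205010's
additive gluing `CSH.additiveGluing_holds` (fk-ref R-g13-1).
(For `q > 1` the statement is OPEN: barrier note `Literature.Barriers.CriticalPhenomena.SamePFreeBoundaryCriteria`.)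
[cite: KozmaNitzan2024, §4 Theorem 6 (pp. 25–31) with Lemmas 9–12] [cite: Grimmett2006, §5.1 (5.1), Conj. (5.103)] -/
theorem fkCriterionOfThetaFree_one (hd : 3 ≤ d) {ε₀ : ℝ} (hε₀ : 0 < ε₀) : FKCriterionOfThetaFree d 1 ε₀ := by
  intro p hp0 hp1 hθ
  rw [thetaFree_one_right_eq_theta] at hθ
  exact ufsc0_one_of_theta_pos hd p hp0 hp1 hθ hε₀

/-- `d = 3` instance: `FKCriterionOfThetaFree 3 1 ε₀` for every `ε₀ > 0` (the `q = 1` conjunct of the typed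
`FKCriterionOfThetaFreeZ3 ε₀`). [cite: KozmaNitzan2024, §4 Theorem 6 (pp. 25–31)] -/
theorem fkCriterionOfThetaFree_three_one {ε₀ : ℝ} (hε₀ : 0 < ε₀) : FKCriterionOfThetaFree 3 1 ε₀ :=
  fkCriterionOfThetaFree_one (by norm_num) hε₀

/-! ### 9. `¬UFSC0` at `p_c` for `q = 1`: the seam `rcCriticalProb_lt_of_ufsc0` regressed through the `q = 1` chain -/

/-- `UFSC0` is monotone in the precision `ε₀`. [cite: KozmaNitzan2024, §4 p. 31 ((33))] -/
theorem UFSC0.mono {q : ℝ} {p : unitInterval} {r : ℕ} {ε₀ ε₁ : ℝ} (hU : UFSC0 d q p r ε₀) (hε : ε₀ ≤ ε₁) :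
    UFSC0 d q p r ε₁ := by
  obtain ⟨S, hSp, hSr, hδ0, hδ1, hO, hbad⟩ := hU
  exact ⟨S, hSp, hSr, hδ0, hδ1, hO, fun h e du hV hdu => (hbad h e du hV hdu).trans hε⟩

/-- **`UFSC0` at `q = 1` makes Kozma–Nitzan's exploration scheme lawful** (tree `HSiteScheme.Lawful`) at
`(p, 4ε₀)`: (32)-FK at the origin is the tree's `hQ0` (`originFK_one_iff`), FK-valid histories are the tree's
valid histories (`validFK_one_iff`), the minimal law `P^x` at `q = 1` is `prodBernoulli (Wfull)` (`fkLaw_Wfull_one`) which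
agrees with `P_p` on the bad event (`KSch.real_bad_eq`), and a failed examination has one of `≤ 4` bad onward
directions (`KSch.not_succ_subset`). [cite: KozmaNitzan2024, §4 pp. 25–31 ((32), (33))] -/
theorem exists_ksch_lawful_of_ufsc0_one {p : unitInterval} {r : ℕ} {ε₀ : ℝ} (hε₀ : 0 ≤ ε₀)
    (hU : UFSC0 d 1 p r ε₀) :
    ∃ S : KSch d, S.p = p ∧ S.C.r = r ∧ 0 < S.δc ∧ S.δc ≤ 1 ∧ S.scheme.Lawful (zdGraph d) p (4 * ε₀) := by
  obtain ⟨S, hSp, hSr, hδ0, hδ1, hO, hbad⟩ := hU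
  refine ⟨S, hSp, hSr, hδ0, hδ1, ?_⟩
  subst hSp
  refine S.lawful (fun du => (originFK_one_iff S du).1 (hO du)) (fun h e hV => ?_)
  have hcard : ((S.onward h (tgt e)).card : ℝ) ≤ 4 := by
    have h1 : (S.onward h (tgt e)).card ≤ Fintype.card MDir := Finset.card_le_univ _
    have h2 : Fintype.card MDir = 4 := by simp [MDir, Fintype.card_prod, Fintype.card_bool, Fintype.card_fin]
    have h3 : (S.onward h (tgt e)).card ≤ 4 := h2 ▸ h1
    exact_mod_cast h3
  calc (bondPercolation (zdGraph d) S.p).real {ω | ¬S.succ h e ((S.probe h e).read ω)}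
      ≤ (bondPercolation (zdGraph d) S.p).real (⋃ du ∈ S.onward h (tgt e), S.bad h e du) :=
        measureReal_mono (KSch.not_succ_subset S h e) (measure_ne_top _ _)
    _ ≤ ∑ du ∈ S.onward h (tgt e), (bondPercolation (zdGraph d) S.p).real (S.bad h e du) :=
        measureReal_biUnion_finset_le _ _
    _ ≤ ∑ du ∈ S.onward h (tgt e), ε₀ := by
        refine Finset.sum_le_sum fun du hdu => ?_
        rw [KSch.real_bad_eq, ← fkLaw_Wfull_one, ← badFK_one_eq]
        exact hbad h e du ((validFK_one_iff S h e).2 hV) hdu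
    _ = (S.onward h (tgt e)).card * ε₀ := by rw [Finset.sum_const, nsmul_eq_mul]
    _ ≤ 4 * ε₀ := mul_le_mul_of_nonneg_right hcard hε₀

/-- **The `q = 1` regression of the seam `rcCriticalProb_lt_of_ufsc0`** (C2 ∧ C3b at `q = 1`, through the tree's
`q = 1` chain): a `UFSC0 d 1 p r ε₀` witness with `4ε₀ < 2⁻³²` and `p > 0` forces `p_c(ℤ^d) < p` — the lawful
scheme of `exists_ksch_lawful_of_ufsc0_one`, its uniform envelope bound (`SameP.card_env_le_of_next`), the
certificate "an infinite macro-cluster forces `0 ↔ ∞`" (`KSch.mem_percolatesVia_of_infinite`) and the same-`p`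
continuation principle `SameP.criticalProb_lt_of_lawful`. [cite: KozmaNitzan2024, §1 p. 2 (approach 1), §4 Theorem 6] -/
theorem criticalProb_lt_of_ufsc0_one {p : unitInterval} (hp0 : 0 < (p : ℝ)) {r : ℕ} {ε₀ : ℝ}
    (hε : 4 * ε₀ < (1 / 2 : ℝ) ^ 32) (hU : UFSC0 d 1 p r ε₀) : criticalProb (zdGraph d) 0 < p := by
  -- w.l.o.g. `0 ≤ ε₀`
  have hU' : UFSC0 d 1 p r (max ε₀ 0) := hU.mono (le_max_left _ _)
  have hε' : 4 * max ε₀ 0 < (1 / 2 : ℝ) ^ 32 := by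
    rcases le_total ε₀ 0 with h | h
    · rw [max_eq_right h]; norm_num
    · rwa [max_eq_left h]
  obtain ⟨S, hSp, -, -, hδc, hL⟩ := exists_ksch_lawful_of_ufsc0_one (le_max_right _ _) hU'
  subst hSp
  have hU₀ : (↑S.scheme.U₀ : Set (Sym2 (Site d))) ⊆ (zdGraph d).edgeSet := fun x hx =>
    (mem_edgesIn_iff.1 (Finset.mem_coe.1 hx)).1
  have hperc : S.scheme.initEvent ∩ {ω | (S.scheme.occFinal ω).Infinite} ⊆
      percolatesAt (0 : Site d) ∪ {ω | ¬ω ⊆ (zdGraph d).edgeSet} := by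
    rintro ω ⟨hA, hinf⟩
    by_cases hωE : ω ⊆ (zdGraph d).edgeSet
    · exact Or.inl (percolatesVia_subset_percolatesAt _ _ (S.mem_percolatesVia_of_infinite hδc hωE hA hinf))
    · exact Or.inr hωE
  exact SameP.criticalProb_lt_of_lawful hL hε' (SameP.card_env_le_of_next S) hU₀ hp0 hperc

/-- The same in the random-cluster vocabulary: `UFSC0 d 1 p r ε₀`, `4ε₀ < 2⁻³²`, `p > 0` ⇒ `p_c(1) < p`
(`p_c(1) = p_c(ℤ^d)`, FO-02). [cite: KozmaNitzan2024, §1 p. 2 (approach 1)] [cite: Grimmett2006, §5.1 (5.3)] -/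
theorem rcCriticalProb_one_lt_of_ufsc0 {p : unitInterval} (hp0 : 0 < (p : ℝ)) {r : ℕ} {ε₀ : ℝ}
    (hε : 4 * ε₀ < (1 / 2 : ℝ) ^ 32) (hU : UFSC0 d 1 p r ε₀) : rcCriticalProb d 1 < p := by
  rw [rcCriticalProb_one_eq_criticalProb]
  exact criticalProb_lt_of_ufsc0_one hp0 hε hU

/-- **`NoUFSC0AtCritical d 1 ε₀` is a tree theorem** for `d ≥ 1` and every `ε₀` with `4ε₀ < 2⁻³²`: at `p = p_c(1) = p_c(ℤ^d) > 0`
the uniform finite-size criterion fails at every scale — else `p_c < p_c`. (The typed `¬UFSC0`-at-criticality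
statement of `ContinuityCruxDefs.lean` at `q = 1`; for `q > 1` it is the consequence `noUFSC0AtCritical_of` of the
programme statements C2 ∧ C3b, not claimed.) [cite: KozmaNitzan2024, §1 p. 2 (approach 1)] [cite: Grimmett2006, Conj. (5.103)] -/
theorem noUFSC0AtCritical_one (hd : 1 ≤ d) {ε₀ : ℝ} (hε : 4 * ε₀ < (1 / 2 : ℝ) ^ 32) : NoUFSC0AtCritical d 1 ε₀ := by
  intro r hU
  have hp0 : 0 < rcCriticalProb d 1 := by
    rw [rcCriticalProb_one_eq_criticalProb]; exact criticalProb_zd_pos d hd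
  exact lt_irrefl _ (rcCriticalProb_one_lt_of_ufsc0 (p := ⟨_, rcCriticalProb_mem_Icc d 1⟩) hp0 hε hU)

end Summit.CriticalPhenomena.PercolationContinuityZ3.Theorems.FK

end
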